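import Mathlib.RepresentationTheory.Irreducible
import Mathlib.RepresentationTheory.Semisimple
import Mathlib.RingTheory.SimpleModule.Basic
import Mathlib.Algebra.DirectSum.Module
import Mathlib.Data.DFinsupp.Module
import HarnessLib

/-!
# Cutting an invariant subspace out of a direct sum of irreducible representations («isotypic cut-out»)

Topic `Literature/RepresentationTheory/Semisimple`; THEOREMS ONLY (no definition, no named fact, no `sorry`).

Let `E ≅ ⊕_{t ∈ T} W_t` be a module (over a ring `R`; for representations: a `k`-linear `G`-equivariant isomorphism onto a direct sum of
representations) whose summands `W_t` have NO proper non-zero submodule (irreducible OR zero).  Let `N ⊆ E` be a submodule (a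
sub-representation) and `p` a property of indices such that
* (H1) for every index `t` with `¬ p t`, every homomorphism (intertwiner) `W_t → E` with image inside `N` vanishes, and
* (H2) for every index `t` with `p t`, the summand `W_t` lies inside `N`.
Then `N` IS the partial sum `⊕_{p t} W_t`: its elements have zero components off `p` (`directSum_apply_eq_zero_of_forall_hom_eq_zero`, from (H1)
alone: `E` is semisimple, so `N` is, so the surjection `N → W_t` would split — Mathlib `IsSemisimpleModule.lifting_property`), membership in `N`
is «components off `p` vanish» (`mem_iff_forall_apply_eq_zero`), and every module `M` mapped injectively and equivariantly ONTO `N` is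
equivariantly isomorphic to `⊕_{t : p t} W_t` (`Representation.exists_equiv_directSum_subtype_of_range_eq`).  This is the elementary
«isotypic cut-out» of semisimple-module bookkeeping (Lang, *Algebra*, XVII §2: every submodule of a semisimple module is a direct summand and a
direct sum of simple submodules; Bourbaki, *Algèbre* VIII §4 n°1 Prop. 1–2), phrased so that the consumer supplies (H1) as a statement about
intertwiners INTO `E` — the shape in which [Liu 2021, Thm 4.18 proof, l. 2258–2266] uses it: the `ν^{alg}`-isotypic part of
`Ω(ν) ⊗ ℚ_ℓ^{ac} ↪ H¹_ét(A_∞) = ⊕_{(μ,ε,χ)} ω(μ,ε,χ) ⊗ ℚ_ℓ^{ac}` is the partial sum over the labels `μ = ν`, because the other labels admit no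
non-zero intertwiner into it (Thm 4.15) and the labels `μ = ν` lie inside it.
Also recorded: Schur's lemma for SEMILINEAR intertwiners between irreducible-or-zero representations over two fields along a surjective
ring homomorphism (`semilinear_eq_zero_or_bijective`; Bourbaki VIII §4 n°3 Prop. 2 for the linear case — kernel and image are subrepresentations),
used by the same consumer for the `Gal(ℂ/M_μ)`-twists of item (3) of [Liu 2021, Thm 4.18].

## References
* [Lang2002] S. Lang, *Algebra*, rev. 3rd ed., GTM 211, XVII §2 (semisimplicity: SS 1–SS 3 and «every submodule … is a direct summand»);
  XVIII §1 (representations = `k[G]`-modules).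
* [BourbakiAlgebreVIII2012] N. Bourbaki, *Algèbre, Ch. VIII*, §4 n°1–3 (semisimple modules, Schur's lemma).
* [Liu2021] Y. Liu, *Fourier–Jacobi cycles and arithmetic relative trace formula*, Camb. J. Math. 9 (2021), Thm 4.18 proof (the consumer).
-/

noncomputable section

open scoped DirectSum

namespace Literature.RepresentationTheory.Semisimple

universe u v w

/-! ## 1. Module form -/

section Module

variable {R : Type*} [Ring R]

/-- A module all of whose submodules are `⊥` or `⊤` (a simple module OR the zero module) is semisimple. (Lang XVII §2.) [cite: Lang2002, XVII §2] -/
theorem isSemisimpleModule_of_forall_eq_bot_or_eq_top {M : Type*} [AddCommGroup M] [Module R M]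
    (h : ∀ N : Submodule R M, N = ⊥ ∨ N = ⊤) : IsSemisimpleModule R M := by
  by_cases hM : Nontrivial M
  · haveI : Nontrivial (Submodule R M) := (Submodule.nontrivial_iff R).mpr hM
    haveI : IsSimpleModule R M := { eq_bot_or_eq_top := h }
    infer_instance
  · haveI : Subsingleton M := not_nontrivial_iff_subsingleton.mp hM
    haveI : ComplementedLattice (Submodule R M) := Subsingleton.instComplementedLattice
    exact ⟨⟩

variable {E : Type*} [AddCommGroup E] [Module R E] {T : Type*} {W : T → Type*}
  [∀ t, AddCommGroup (W t)] [∀ t, Module R (W t)]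

/-- **Components off the cut vanish.**  `Φ : E ≃ ⊕_t W_t` with every `W_t` simple-or-zero, `N ⊆ E` a submodule, `s` an index such that every
homomorphism `W_s → E` with image in `N` is zero: then every element of `N` has zero `s`-component.  (`E`, hence `N`, is semisimple; were the
`s`-component map `N → W_s` non-zero it would be onto, hence split by Mathlib's `IsSemisimpleModule.lifting_property`, and the splitting is a non-zero
homomorphism `W_s → N`.)  Lang XVII §2 («every submodule of a semisimple module is a direct summand»). [cite: Lang2002, XVII §2] -/
theorem directSum_apply_eq_zero_of_forall_hom_eq_zero (hW : ∀ (t : T) (N' : Submodule R (W t)), N' = ⊥ ∨ N' = ⊤)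
    (Φ : E ≃ₗ[R] ⨁ t, W t) (N : Submodule R E) (s : T) (H1 : ∀ f : W s →ₗ[R] E, (∀ w, f w ∈ N) → f = 0) :
    ∀ n ∈ N, Φ n s = 0 := by
  classical
  haveI : ∀ t, IsSemisimpleModule R (W t) := fun t => isSemisimpleModule_of_forall_eq_bot_or_eq_top (hW t)
  haveI : IsSemisimpleModule R (⨁ t, W t) := inferInstanceAs (IsSemisimpleModule R (Π₀ t, W t))
  haveI : IsSemisimpleModule R E := IsSemisimpleModule.congr Φ
  let q : N →ₗ[R] W s := (DirectSum.component R T W s ∘ₗ Φ.toLinearMap) ∘ₗ N.subtype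
  have hq_apply : ∀ n : N, q n = Φ (n : E) s := fun n => rfl
  by_contra hcon
  push Not at hcon
  obtain ⟨n, hn, hns⟩ := hcon
  have hq : q ≠ 0 := fun h0 => hns (by rw [← hq_apply ⟨n, hn⟩, h0, LinearMap.zero_apply])
  have hsurj : Function.Surjective q := by
    rcases hW s (LinearMap.range q) with h | h
    · exact absurd (LinearMap.range_eq_bot.1 h) hq
    · exact LinearMap.range_eq_top.1 h
  obtain ⟨g, hg⟩ := IsSemisimpleModule.lifting_property q hsurj (LinearMap.id : W s →ₗ[R] W s)
  have hzero : N.subtype ∘ₗ g = 0 := H1 (N.subtype ∘ₗ g) (fun w => (g w).2)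
  have hg0 : ∀ w, g w = 0 := fun w => by
    have h1 := LinearMap.congr_fun hzero w
    rw [LinearMap.comp_apply, LinearMap.zero_apply, Submodule.subtype_apply] at h1
    exact Subtype.ext h1
  have hW0 : ∀ x : W s, x = 0 := fun x => by
    have h1 := LinearMap.congr_fun hg x
    rw [LinearMap.comp_apply, hg0, map_zero, LinearMap.id_apply] at h1
    exact h1.symm
  exact hq (LinearMap.ext fun x => hW0 (q x))

end Module

/-! ## 2. Representations: `k`-linear `G`-equivariant form -/

section Representation

variable {k : Type u} [Field k] {G : Type v} [Monoid G]
variable {E : Type w} [AddCommGroup E] [Module k E] (ρE : Representation k G E)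
variable {T : Type*} {W : T → Type w} [∀ t, AddCommGroup (W t)] [∀ t, Module k (W t)]
  (σ : ∀ t, Representation k G (W t))

/-- Irreducible-or-zero at the level of `k[G]`-submodules of `ρ.asModule` (Mathlib's order isomorphism
`Subrepresentation ρ ≃o Submodule k[G] ρ.asModule`). [cite: Lang2002, XVIII §1] -/
theorem submodule_asModule_eq_bot_or_eq_top {V : Type*} [AddCommGroup V] [Module k V] (ρ : Representation k G V)
    (h : ∀ V' : Subrepresentation ρ, V' = ⊥ ∨ V' = ⊤) (N' : Submodule (MonoidAlgebra k G) ρ.asModule) :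
    N' = ⊥ ∨ N' = ⊤ := by
  rcases h (Subrepresentation.subrepresentationSubmoduleOrderIso.symm N') with h1 | h1
  · left
    have := congrArg Subrepresentation.subrepresentationSubmoduleOrderIso h1
    rwa [OrderIso.apply_symm_apply, OrderIso.map_bot] at this
  · right
    have := congrArg Subrepresentation.subrepresentationSubmoduleOrderIso h1
    rwa [OrderIso.apply_symm_apply, OrderIso.map_top] at this

/-- A `k`-linear `G`-equivariant isomorphism `E ≃ ⊕_t W_t` is `k[G]`-linear between the `k[G]`-modules `ρE.asModule` and
`⊕_t (σ t).asModule` (Lang XVIII §1 dictionary; stated as an existence so that this file declares theorems only).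
[cite: Lang2002, XVIII §1] -/
theorem exists_linearEquiv_asModule (Φ : E ≃ₗ[k] ⨁ t, W t)
    (hΦ : ∀ (g : G) (e : E) (t : T), Φ (ρE g e) t = σ t g (Φ e t)) :
    ∃ Φ' : ρE.asModule ≃ₗ[MonoidAlgebra k G] ⨁ t, (σ t).asModule, ∀ (e : E) (t : T), Φ' e t = Φ e t :=
  ⟨{ toFun := fun e => Φ e
     invFun := fun y => Φ.symm y
     left_inv := fun e => Φ.symm_apply_apply e
     right_inv := fun y => Φ.apply_symm_apply y
     map_add' := fun x y => Φ.map_add x y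
     map_smul' := fun x e => by
       apply DirectSum.ext
       intro t
       change Φ (ρE.asAlgebraHom x e) t = (σ t).asAlgebraHom x (Φ e t)
       induction x using MonoidAlgebra.induction_linear with
       | zero => simp only [map_zero, LinearMap.zero_apply, DirectSum.zero_apply]
       | add x y hx hy => simp only [map_add, LinearMap.add_apply, DirectSum.add_apply, hx, hy]
       | single g a =>
         rw [Representation.asAlgebraHom_single, Representation.asAlgebraHom_single, LinearMap.smul_apply,
           LinearMap.smul_apply, map_smul, ← hΦ]
         rfl }, fun _ _ => rfl⟩

/-- **Components off the cut vanish (representations).**  `Φ : E ≃ ⊕_t W_t` `k`-linear and `G`-equivariant, every `σ t` irreducible or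
zero, `N` a subrepresentation of `E`, and `s` an index such that every `G`-equivariant `k`-linear `f : W_s → E` with image inside `N` vanishes:
then every element of `N` has zero `s`-component. [cite: Lang2002, XVII §2; XVIII §1] -/
theorem _root_.Representation.directSum_apply_eq_zero_of_forall_intertwiner_eq_zero
    (hirr : ∀ (t : T) (W' : Subrepresentation (σ t)), W' = ⊥ ∨ W' = ⊤)
    (Φ : E ≃ₗ[k] ⨁ t, W t) (hΦ : ∀ (g : G) (e : E) (t : T), Φ (ρE g e) t = σ t g (Φ e t))
    (N : Subrepresentation ρE) (s : T)
    (H1 : ∀ f : W s →ₗ[k] E, (∀ (g : G) (w : W s), f (σ s g w) = ρE g (f w)) → (∀ w, f w ∈ N) → f = 0) :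
    ∀ n ∈ N, Φ n s = 0 := by
  intro n hn
  obtain ⟨Φ', hΦ'⟩ := exists_linearEquiv_asModule ρE σ Φ hΦ
  have key := directSum_apply_eq_zero_of_forall_hom_eq_zero (R := MonoidAlgebra k G) (E := ρE.asModule)
    (W := fun t => (σ t).asModule) (fun t => submodule_asModule_eq_bot_or_eq_top (σ t) (hirr t))
    Φ' N.asSubmodule s ?_ n ((Subrepresentation.mem_asSubmodule_iff (σ := N) (v := n)).2 hn)
  · rw [hΦ'] at key
    exact key
  · intro f hf
    -- `f` restricted to scalars `k` is a `G`-equivariant `k`-linear map `W s → E` with image in `N`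
    let f₀ : W s →ₗ[k] E :=
      { toFun := fun w => f w
        map_add' := fun x y => f.map_add x y
        map_smul' := fun a w => by
          have h1 := f.map_smul (algebraMap k (MonoidAlgebra k G) a) w
          rw [algebraMap_smul, algebraMap_smul] at h1
          exact h1 }
    have hf₀ : f₀ = 0 := by
      refine H1 f₀ (fun g w => ?_) (fun w => (Subrepresentation.mem_asSubmodule_iff (σ := N) (v := f w)).1 (hf w))
      have h1 := f.map_smul (MonoidAlgebra.single g (1 : k)) w
      rw [Representation.single_smul, Representation.single_smul, one_smul, one_smul] at h1
      exact h1
    apply LinearMap.ext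
    intro w
    exact LinearMap.congr_fun hf₀ w

/-- **Membership in the cut-out subrepresentation is «components off `p` vanish».**  Under (H1) for the indices with `¬ p t` and (H2)
`W_t ⊆ N` for the indices with `p t`. [cite: Lang2002, XVII §2; XVIII §1] -/
theorem _root_.Representation.mem_iff_forall_directSum_apply_eq_zero [DecidableEq T]
    (hirr : ∀ (t : T) (W' : Subrepresentation (σ t)), W' = ⊥ ∨ W' = ⊤)
    (Φ : E ≃ₗ[k] ⨁ t, W t) (hΦ : ∀ (g : G) (e : E) (t : T), Φ (ρE g e) t = σ t g (Φ e t))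
    (N : Subrepresentation ρE) (p : T → Prop)
    (H1 : ∀ t, ¬ p t → ∀ f : W t →ₗ[k] E, (∀ (g : G) (w : W t), f (σ t g w) = ρE g (f w)) → (∀ w, f w ∈ N) → f = 0)
    (H2 : ∀ t, p t → ∀ w : W t, Φ.symm (DirectSum.lof k T W t w) ∈ N) (e : E) :
    e ∈ N ↔ ∀ t, ¬ p t → Φ e t = 0 := by
  classical
  constructor
  · intro he t ht
    exact Representation.directSum_apply_eq_zero_of_forall_intertwiner_eq_zero ρE σ hirr Φ hΦ N t (H1 t ht) e he
  · intro h
    have hsum : Φ e = ∑ t ∈ (Φ e).support, DirectSum.lof k T W t (Φ e t) := by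
      simpa only [DirectSum.lof_eq_of] using (DirectSum.sum_support_of (Φ e)).symm
    have he : e = ∑ t ∈ (Φ e).support, Φ.symm (DirectSum.lof k T W t (Φ e t)) := by
      rw [← map_sum, ← hsum, LinearEquiv.symm_apply_apply]
    rw [he]
    refine N.toSubmodule.sum_mem fun t ht => ?_
    by_cases hp : p t
    · exact H2 t hp _
    · exfalso
      exact (DFinsupp.mem_support_iff.1 ht) (h t hp)

/-- **Isotypic cut-out as an equivariant isomorphism.**  `Φ : E ≃ ⊕_t W_t` `k`-linear `G`-equivariant onto irreducible-or-zero summands,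
`N ⊆ E` a subrepresentation satisfying (H1) off `p` and (H2) on `p`, and `Ψ : M → E` an injective `G`-equivariant `k`-linear map with image
exactly `N`: then `M ≅ ⊕_{t : p t} W_t`, `k`-linearly and `G`-equivariantly (`Θ m t = Φ (Ψ m) t.1`).  Lang XVII §2 / Bourbaki VIII §4 n°1.
[cite: Lang2002, XVII §2; XVIII §1] [cite: BourbakiAlgebreVIII2012, VIII §4 n°1 Prop. 1–2] -/
theorem _root_.Representation.exists_equiv_directSum_subtype_of_range_eq [DecidableEq T]
    (hirr : ∀ (t : T) (W' : Subrepresentation (σ t)), W' = ⊥ ∨ W' = ⊤)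
    (Φ : E ≃ₗ[k] ⨁ t, W t) (hΦ : ∀ (g : G) (e : E) (t : T), Φ (ρE g e) t = σ t g (Φ e t))
    (N : Subrepresentation ρE) (p : T → Prop)
    (H1 : ∀ t, ¬ p t → ∀ f : W t →ₗ[k] E, (∀ (g : G) (w : W t), f (σ t g w) = ρE g (f w)) → (∀ w, f w ∈ N) → f = 0)
    (H2 : ∀ t, p t → ∀ w : W t, Φ.symm (DirectSum.lof k T W t w) ∈ N)
    {M : Type*} [AddCommGroup M] [Module k M] (ρM : Representation k G M) (Ψ : M →ₗ[k] E)
    (hΨinj : Function.Injective Ψ) (hΨG : ∀ (g : G) (m : M), Ψ (ρM g m) = ρE g (Ψ m))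
    (hΨN : ∀ e : E, e ∈ N ↔ e ∈ Set.range Ψ) :
    ∃ Θ : M ≃ₗ[k] ⨁ t : {t // p t}, W t.1,
      (∀ (m : M) (t : {t // p t}), Θ m t = Φ (Ψ m) t.1) ∧
      ∀ (g : G) (m : M) (t : {t // p t}), Θ (ρM g m) t = σ t.1 g (Θ m t) := by
  classical
  -- restriction to the indices `p` and extension by zero
  let r : (⨁ t, W t) →ₗ[k] ⨁ t : {t // p t}, W t.1 := DFinsupp.subtypeDomainLinearMap k W p
  have hr : ∀ (x : ⨁ t, W t) (t : {t // p t}), r x t = x t.1 := fun x t => rfl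
  let ex : (⨁ t : {t // p t}, W t.1) →ₗ[k] ⨁ t, W t :=
    DirectSum.toModule k {t // p t} (⨁ t, W t) fun t => DirectSum.lof k T W t.1
  have hex_mem : ∀ y : ⨁ t : {t // p t}, W t.1, Φ.symm (ex y) ∈ N := by
    intro y
    induction y using DirectSum.induction_on with
    | zero => rw [map_zero, map_zero]; exact N.toSubmodule.zero_mem
    | of t w =>
      rw [show (DirectSum.of (fun t : {t // p t} => W t.1) t w) = DirectSum.lof k {t // p t} (fun t => W t.1) t w from rfl,
        DirectSum.toModule_lof]
      exact H2 t.1 t.2 w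
    | add x y hx hy => rw [map_add, map_add]; exact N.toSubmodule.add_mem hx hy
  have hex_apply : ∀ (y : ⨁ t : {t // p t}, W t.1) (t : {t // p t}), ex y t.1 = y t := by
    intro y
    induction y using DirectSum.induction_on with
    | zero => intro t; rw [map_zero]; rfl
    | of t₀ w =>
      intro t
      rw [show (DirectSum.of (fun t : {t // p t} => W t.1) t₀ w) = DirectSum.lof k {t // p t} (fun t => W t.1) t₀ w from rfl,
        DirectSum.toModule_lof, DirectSum.lof_eq_of, DirectSum.lof_eq_of]
      by_cases h : t₀ = t
      · subst h
        rw [DirectSum.of_eq_same, DirectSum.of_eq_same]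
      · have h1 : (t : T) ≠ (t₀ : T) := fun h' => h (Subtype.ext h').symm
        rw [DirectSum.of_eq_of_ne _ _ _ h1, DirectSum.of_eq_of_ne _ _ _ (Ne.symm h)]
    | add x y hx hy => intro t; rw [map_add, DirectSum.add_apply, DirectSum.add_apply, hx, hy]
  -- the candidate isomorphism
  let θ : M →ₗ[k] ⨁ t : {t // p t}, W t.1 := r ∘ₗ Φ.toLinearMap ∘ₗ Ψ
  have hθ : ∀ (m : M) (t : {t // p t}), θ m t = Φ (Ψ m) t.1 := fun m t => rfl
  have hinj : Function.Injective θ := by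
    intro m₁ m₂ h12
    apply hΨinj
    apply Φ.injective
    apply DFinsupp.ext
    intro t
    by_cases hp : p t
    · have := congrArg (fun y => y ⟨t, hp⟩) h12
      simpa only [hθ] using this
    · have h1 : Ψ m₁ ∈ N := (hΨN _).2 ⟨m₁, rfl⟩
      have h2 : Ψ m₂ ∈ N := (hΨN _).2 ⟨m₂, rfl⟩
      rw [Representation.directSum_apply_eq_zero_of_forall_intertwiner_eq_zero ρE σ hirr Φ hΦ N t (H1 t hp) _ h1,
        Representation.directSum_apply_eq_zero_of_forall_intertwiner_eq_zero ρE σ hirr Φ hΦ N t (H1 t hp) _ h2]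
  have hsurj : Function.Surjective θ := by
    intro y
    obtain ⟨m, hm⟩ := (hΨN _).1 (hex_mem y)
    refine ⟨m, ?_⟩
    apply DFinsupp.ext
    intro t
    rw [hθ, hm, LinearEquiv.apply_symm_apply, hex_apply]
  refine ⟨LinearEquiv.ofBijective θ ⟨hinj, hsurj⟩, fun m t => rfl, fun g m t => ?_⟩
  rw [LinearEquiv.ofBijective_apply, LinearEquiv.ofBijective_apply, hθ, hθ, hΨG, hΦ]

end Representation

/-! ## 3. Schur's lemma for semilinear intertwiners -/

section SemilinearSchur

variable {k₁ k₂ : Type*} [Field k₁] [Field k₂] {τ : k₁ →+* k₂} [RingHomSurjective τ]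
variable {G : Type*} [Monoid G] {V : Type*} [AddCommGroup V] [Module k₁ V] {W : Type*} [AddCommGroup W] [Module k₂ W]

/-- **Schur's lemma, semilinear form.**  A `τ`-SEMILINEAR map `f : V → W` between representations of `G` over two fields (`τ : k₁ → k₂`
a surjective ring homomorphism, e.g. a field automorphism) intertwining the actions is either zero or bijective, provided source and target are
each irreducible or zero: its kernel and its image are subrepresentations. (Bourbaki VIII §4 n°3 Prop. 2, linear case; the semilinear case is
the same argument.) [cite: BourbakiAlgebreVIII2012, VIII §4 n°3 Prop. 2] -/
theorem semilinear_eq_zero_or_bijective (ρ : Representation k₁ G V) (σ : Representation k₂ G W)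
    (hρ : ∀ V' : Subrepresentation ρ, V' = ⊥ ∨ V' = ⊤) (hσ : ∀ W' : Subrepresentation σ, W' = ⊥ ∨ W' = ⊤)
    (f : V →ₛₗ[τ] W) (hf : ∀ (g : G) (v : V), f (ρ g v) = σ g (f v)) :
    f = 0 ∨ Function.Bijective f := by
  -- kernel and range as subrepresentations
  let K : Subrepresentation ρ := ⟨LinearMap.ker f, fun g v hv => by
    rw [LinearMap.mem_ker] at hv ⊢
    rw [hf, hv, map_zero]⟩
  let I : Subrepresentation σ := ⟨LinearMap.range f, fun g w hw => by
    obtain ⟨v, rfl⟩ := LinearMap.mem_range.1 hw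
    exact LinearMap.mem_range.2 ⟨ρ g v, hf g v⟩⟩
  rcases hρ K with hK | hK
  · -- `ker f = ⊥`: injective; then the range decides
    have hker : LinearMap.ker f = ⊥ := congrArg Subrepresentation.toSubmodule hK
    rcases hσ I with hI | hI
    · left
      have hrange : LinearMap.range f = ⊥ := congrArg Subrepresentation.toSubmodule hI
      exact LinearMap.range_eq_bot.1 hrange
    · right
      have hrange : LinearMap.range f = ⊤ := congrArg Subrepresentation.toSubmodule hI
      exact ⟨LinearMap.ker_eq_bot.1 hker, LinearMap.range_eq_top.1 hrange⟩
  · left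
    have hker : LinearMap.ker f = ⊤ := congrArg Subrepresentation.toSubmodule hK
    exact LinearMap.ker_eq_top.1 hker

end SemilinearSchur

end Literature.RepresentationTheory.Semisimple

end
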